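import Literature.AlgebraicGeometry.HodgeTheory.LocallyTrivialExtensionClasses

/-!
# Route LinearSystemTorelli — crux `LocalTubeSpan`: `LocTriv(D)` = the locally undetected classes

Helper file (`--supports stmt-HodgeConjecture-2490`, line `Sketch`, cycle 6, stub
`stub_locTrivCharacterisation`): "LocTriv(D) = locally undetected classes, granting
LocalTubeSpanCFree along D".  The crux ("local Schnell theorem", C. Schnell, *Primitive cohomology
and the tube mapping*, Math. Z. 268 (2010) = arXiv:0711.3927, §3, §7) in its c-free COLIMIT form at
a point `t₀ ∈ T` says: a class `ξ ∈ H¹(π₁(S, s), V_s)` undetected by Schnell's third map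
`evalCoinvOn` on the local subgroups `localSubgroup ι s N hs' γ` of SOME neighbourhood `N` of `t₀`
lies in the tree's local kernel `localKernel ι V s t₀` (the kernel of
`H¹(S, 𝕍) → colim_{U ∋ t₀} H¹(U ∩ S, 𝕍)` of P. Brosnan, H. Fang, Z. Nie, G. Pearlstein,
*Singularities of admissible normal functions*, Invent. Math. 177 (2009), §1 eq. (1)).

This file is the route-facing dictionary: GRANTING the crux at every point of `D ⊆ T` (the
hypothesis `hcfree`), the locally trivial classes along `D`
(`locallyTrivialClasses ι V s D = ⨅_{t₀ ∈ D} localKernel ι V s t₀` — the part of `H¹` of the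
discriminant-complement group that no local fundamental group at `D` sees) are EXACTLY the classes
undetected element-wise near every point of `D`:

* `localTubeSpan_locTrivCharacterisation` — the registered stub: (→) unfold
  `mem_locallyTrivialClasses_iff` / `mem_localKernel_iff` to a neighbourhood all of whose local
  subgroups have `ξ` in their restriction kernel, and restriction kernels die under `evalCoinvOn`
  (`H1resKer_le_ker_evalCoinvOn`); (←) is `hcfree` pointwise.

Pure bookkeeping over the tree's `LocallyTrivialExtensionClasses` (an arbitrary commutative ring
`k`, continuous `ι : S → T`, local system `V` and base point `s`); no named facts.

References: [Schnell2010] C. Schnell, Primitive cohomology and the tube mapping, Math. Z. 268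
(2010), §3 (the third map); [BrosnanFangNiePearlstein2009] P. Brosnan, H. Fang, Z. Nie,
G. Pearlstein, Singularities of admissible normal functions, Invent. Math. 177 (2009), §1 eq. (1).
-/

-- `Summit.HodgeConjecture.HodgeConjecture.Theorems` is the mandated namespace (single-conjunct summit:
-- Sub = Summit), which `linter.dupNamespace` flags on every declaration; the lakefile turns the
-- linter off tree-wide (weak option), restated here so stand-alone elaboration is warning-free too.
set_option linter.dupNamespace false

noncomputable section

open _root_.Topology Filter
open Literature.AlgebraicGeometry Literature.AlgebraicGeometry.HodgeTheory
open CategoryTheory groupCohomology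

namespace Summit.HodgeConjecture.HodgeConjecture.Theorems

universe u v

/-! ### `LocTriv(D)` is the space of locally undetected classes, granting the crux along `D` -/

/-- **Dictionary: locally trivial = locally undetected, granting the c-free local Schnell theorem
along `D`.** If at every `t₀ ∈ D` a class undetected by Schnell's third map `evalCoinvOn` on the
local subgroups of some neighbourhood of `t₀` lies in the local kernel at `t₀` (hypothesis `hcfree`,
the crux `LocalTubeSpan` in colimit form), then `ξ ∈ LocTriv(D) = ⨅_{t₀ ∈ D} localKernel ι V s t₀`
iff near every point of `D` no element of a local fundamental group detects `ξ`
(`φ g ∈ (g - 1)V_s` for all `g` in the local subgroups of some neighbourhood).  The forward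
direction is unconditional: a class restricting to zero on a subgroup is undetected by every
element of it (`H1resKer_le_ker_evalCoinvOn`). [cite: BrosnanFangNiePearlstein2009, §1 eq. (1)] -/
theorem localTubeSpan_locTrivCharacterisation {k S : Type u} [CommRing k] [TopologicalSpace S]
    {T : Type v} [TopologicalSpace T]
    (ι : C(S, T)) (V : Literature.AlgebraicGeometry.Motives.LocalSystem k S) (s : S) (D : Set T)
    (hcfree : ∀ t₀ ∈ D, ∀ ξ : groupCohomology.H1 (monodromyRepObj V s),
      (∃ N ∈ 𝓝 t₀, ∀ (s' : S) (hs' : ι s' ∈ N) (γ : Path s' s),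
        evalCoinvOn (monodromyRepObj V s) (localSubgroup ι s N hs' γ) ξ = 0) →
      ξ ∈ localKernel ι V s t₀)
    (ξ : groupCohomology.H1 (monodromyRepObj V s)) :
    ξ ∈ locallyTrivialClasses ι V s D ↔
      ∀ t₀ ∈ D, ∃ N ∈ 𝓝 t₀, ∀ (s' : S) (hs' : ι s' ∈ N) (γ : Path s' s),
        evalCoinvOn (monodromyRepObj V s) (localSubgroup ι s N hs' γ) ξ = 0 := by
  rw [mem_locallyTrivialClasses_iff]
  refine ⟨fun hξ t₀ ht₀ => ?_, fun hξ t₀ ht₀ => hcfree t₀ ht₀ ξ (hξ t₀ ht₀)⟩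
  obtain ⟨N, hN, hker⟩ := (mem_localKernel_iff ι V s t₀ ξ).1 (hξ t₀ ht₀)
  exact ⟨N, hN, fun s' hs' γ =>
    LinearMap.mem_ker.1 (H1resKer_le_ker_evalCoinvOn (monodromyRepObj V s) _ (hker s' hs' γ))⟩

end Summit.HodgeConjecture.HodgeConjecture.Theorems

end
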